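import Summits.ValiantsHypothesis.ValiantsHypothesis.Theorems.KPlusLogSqLawTropicalBLexShiftArc

/-!
# Route «KPlusLogSqLaw», crux `TropicalB` (stmt-ValiantsHypothesis-19771) — LEX-NT, part 10b (combinatorics): the two-bad arc lemma when `p` is a
# FIXED bad `ρ`-column (the C-shared case of the second lex core law), `m ≥ 6`

HONEST FRAMING.  Pure combinatorics (seat val-sym-trop-p5 g14, 2026-08-28; cell `pub-symmetroid`, `--supports stmt-ValiantsHypothesis-19771 --as helper`),
sequel of `…TropicalBLexShiftArc`: the same arc conclusion when `ρ` may also fix `p`, provided `p` is then one of the bad `ρ`-columns `r₁, r₂`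
(`r₁ ≠ r₂`, `y ∉ {r₁, r₂}`) and `m ≥ 6`.  Winding-number count as before: with `p` fixed the arcs through `p` number exactly `w`, the moved bad `ρ`-column
is unique, so again `w ≥ #moved − 1` and `#coincidences ≥ m − 2·#fixed` with `#coincidences ≤ 1 + [y moved]`, `#fixed = 1 + [y fixed]` ⇒ `m ≤ 5`.
(At `m = 5` the purely combinatorial statement fails in four configurations with `p` and `y` both fixed — seat folder exp/t1_arc2.py — so the bound `6`
is sharp for this lemma; the corresponding `T_1` configurations are nevertheless excluded by the exchange laws, exp/t1_sc.py.)  This is the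
combinatorial step of the C-SHARED case (`γ p = α p`, `β p ≠ α p`) of the conjectured second lex core law; the assembly is not in this file.  Nothing here
bears on `TropicalB` in its window, `WeakLifting`, DoorA26 / DoorA34, `MatrixDescartes` (stmt-ValiantsHypothesis-18050) or VP ≠ VNP.  [this cell]
-/

set_option linter.dupNamespace false
set_option autoImplicit false

namespace Summit.ValiantsHypothesis.ValiantsHypothesis.Theorems.KPlusLogSqLaw

namespace LexCore

open Finset

variable {m : ℕ}

/-- **THE TWO-BAD ARC LEMMA with `p` possibly `ρ`-fixed** (then `p` must be a bad `ρ`-column): same conclusion for `m ≥ 6`. [this cell] -/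
theorem arc_lemma_fixed (hm : 6 ≤ m) (π ρ : Equiv.Perm (Fin m)) (pos : Fin m → ℕ) (hinj : Function.Injective pos) (hlt : ∀ b, pos b < m)
    (hstep : ∀ b, pos b + 1 < m → pos (π b) = pos b + 1) (hwrap : ∀ b, pos b + 1 = m → pos (π b) = 0)
    (p q₁ q₂ r₁ r₂ y : Fin m) (hr : r₁ ≠ r₂) (hy1 : y ≠ r₁) (hy2 : y ≠ r₂) (hcyc : ∀ b, π.SameCycle p b)
    (hfix : ∀ b, ρ b = b → (b = y ∧ y ≠ p) ∨ (b = p ∧ (p = r₁ ∨ p = r₂)))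
    (hcoin : ∀ b, ρ b = π b → b = r₁ ∨ b = r₂ ∨ (b = y ∧ y ≠ q₁ ∧ y ≠ q₂))
    (D : Fin m → Fin m → ℕ) (hD : ∀ c x, D c x = if pos c ≤ pos x then pos x - pos c else pos x + m - pos c) :
    ∃ b, ρ b ≠ b ∧
      (if D (ρ b) q₁ < D (ρ b) b then 1 else 0) + (if D (ρ b) q₂ < D (ρ b) b then 1 else 0) +
        (if b = r₁ ∨ b = r₂ then 1 else 0) + (if D (ρ b) p ≤ D (ρ b) b then 0 else 1) ≤ 1 := by
  classical
  obtain ⟨hDlt, hD0, hDinj⟩ := clock_basic pos hinj hlt D hD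
  have hDstep := clock_step π pos hlt hstep hwrap D hD
  -- if `p` is moved this is `arc_lemma`
  by_cases hp : ρ p ≠ p
  · have hfix' : ∀ b, ρ b = b → b = y ∧ y ≠ p := by
      intro b hb
      rcases hfix b hb with h | h
      · exact h
      · exact absurd (h.1 ▸ hb) hp
    exact arc_lemma (by omega) π ρ pos hinj hlt hstep hwrap p q₁ q₂ r₁ r₂ y hcyc hfix' hcoin D hD
  push Not at hp
  -- now `p` is a fixed bad `ρ`-column
  have hpR : p = r₁ ∨ p = r₂ := by
    rcases hfix p hp with h | h
    · exact absurd h.1.symm h.2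
    · exact h.2
  by_contra H
  push Not at H
  -- `H : ∀ b, ρ b ≠ b → 1 < (bad count) + [p ∉ I_b]`
  -- the moved columns
  set NF : Finset (Fin m) := univ.filter fun b => ρ b ≠ b with hNF
  have memNF : ∀ b, b ∈ NF ↔ ρ b ≠ b := fun b => by simp [hNF]
  have hpNF : p ∉ NF := fun h => ((memNF p).mp h) hp
  -- the other bad `ρ`-column is moved
  have hfixsub : ∀ b, ρ b = b → b = y ∨ b = p := fun b hb => by
    rcases hfix b hb with h | h
    · exact Or.inl h.1
    · exact Or.inr h.1
  have hr1NF : r₁ ≠ p → r₁ ∈ NF := fun h1 => (memNF r₁).mpr fun hb => by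
    rcases hfixsub r₁ hb with h | h
    · exact hy1 h.symm
    · exact h1 h
  have hr2NF : r₂ ≠ p → r₂ ∈ NF := fun h2 => (memNF r₂).mpr fun hb => by
    rcases hfixsub r₂ hb with h | h
    · exact hy2 h.symm
    · exact h2 h
  -- arc lengths
  have hL1 : ∀ b, ρ b ≠ b → 1 ≤ D (ρ b) b := by
    intro b hb
    by_contra h
    exact hb ((hD0 (ρ b) b).mp (by omega))
  have hLm : ∀ b, D (ρ b) b ≤ m - 1 := fun b => by have := hDlt (ρ b) b; omega
  -- an arc of length `m − 1` is a coincidence `ρ b = π b`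
  have hLcoin : ∀ b, D (ρ b) b = m - 1 → ρ b = π b := by
    intro b h
    have e := hDstep (ρ b) b
    rw [h, if_pos (by omega)] at e
    exact (hD0 (ρ b) (π b)).mp e
  -- `π` moves every column
  have hπne : ∀ b, π b ≠ b := by
    intro b h
    have e := hDstep b b
    rw [h, (hD0 b b).mpr rfl] at e
    (split_ifs at e with h1; omega)
  -- coverage by half-open arcs
  set cov : Fin m → ℕ := fun x => (NF.filter fun b => D (ρ b) x < D (ρ b) b).card with hcov
  -- one `π`-step does not change the coverage
  have cov_step : ∀ x, cov (π x) = cov x := by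
    intro x
    by_cases hfx : ρ (π x) = (π x)
    · -- `(π x)` fixed: the two arc families coincide
      simp only [hcov]
      congr 1
      ext b
      simp only [Finset.mem_filter, memNF]
      constructor
      · rintro ⟨hb, h⟩
        refine ⟨hb, ?_⟩
        have e := hDstep (ρ b) x
        have hne : D (ρ b) x + 1 ≠ m := by
          intro hm1
          -- then `π x = ρ b`, so `b = ρ⁻¹ (π x) ` is fixed-related: `ρ b = (π x)` with `(π x)` fixed gives `b = (π x)`, against `hb`
          rw [if_pos hm1] at e
          have : ρ b = (π x) := (hD0 (ρ b) (π x)).mp e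
          have hbx : b = (π x) := ρ.injective (this.trans hfx.symm)
          rw [hbx] at hb; exact hb hfx
        rw [if_neg hne] at e
        omega
      · rintro ⟨hb, h⟩
        refine ⟨hb, ?_⟩
        have e := hDstep (ρ b) x
        by_cases hne : D (ρ b) x + 1 = m
        · -- `π x = ρ b`: impossible as above
          rw [if_pos hne] at e
          have : ρ b = (π x) := (hD0 (ρ b) (π x)).mp e
          have hbx : b = (π x) := ρ.injective (this.trans hfx.symm)
          rw [hbx] at hb; exact absurd hfx hb
        · rw [if_neg hne] at e
          -- `D (π x) = D x + 1 < L` unless `b = (π x)`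
          have hlt' : D (ρ b) x + 1 < D (ρ b) b ∨ D (ρ b) x + 1 = D (ρ b) b := by omega
          rcases hlt' with h' | h'
          · omega
          · exfalso
            -- `D (ρ b) (π x) = D (ρ b) b` forces `b = (π x)`, fixed
            have : (π x) = b := hDinj (ρ b) (π x) b (by rw [e, h'])
            rw [← this] at hb; exact hb hfx
    · -- `(π x)` moved: the arc of `(π x)` covers `x` but not `(π x)`; the arc of `u = ρ⁻¹ (π x)` covers `(π x)` but not `x`
      set u := ρ⁻¹ (π x) with hu
      have hρu : ρ u = (π x) := by simp [hu]
      have hux : u ≠ (π x) := by intro h; apply hfx; rw [← h, hρu, h]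
      have huNF : ρ u ≠ u := by rw [hρu]; exact fun h => hux h.symm
      have key : NF.filter (fun b => D (ρ b) x < D (ρ b) b) =
          insert (π x) ((NF.filter fun b => D (ρ b) (π x) < D (ρ b) b).erase u) := by
        ext b
        simp only [Finset.mem_filter, Finset.mem_insert, Finset.mem_erase, memNF]
        constructor
        · rintro ⟨hb, h⟩
          by_cases hbx : b = (π x)
          · exact Or.inl hbx
          · right
            have e := hDstep (ρ b) x
            have hne : D (ρ b) x + 1 ≠ m := by
              intro hm1
              rw [if_pos hm1] at e
              have : ρ b = (π x) := (hD0 (ρ b) (π x)).mp e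
              -- then `b = u`, and `D (ρ u) x = m − 1 ≥ L u`: contradiction with `h`
              have hbu : b = u := by rw [hu, ← this]; simp
              rw [hbu, hρu] at h
              have : D (π x) x = m - 1 := by
                have e' := hDstep (π x) x
                rw [(hD0 (π x) (π x)).mpr rfl] at e'
                (split_ifs at e' with h1; omega)
              rw [this] at h
              have := hLm u; rw [hρu] at this; omega
            rw [if_neg hne] at e
            refine ⟨fun hbu => ?_, hb, ?_⟩
            · -- `b = u`: `D (ρ u) x + 1 = m`
              apply hne
              rw [hbu, hρu]
              have e' := hDstep (π x) x
              rw [(hD0 (π x) (π x)).mpr rfl] at e'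
              (split_ifs at e' with h1; omega)
            · -- `D (π x) < L`, else `b = (π x)`
              have hlt' : D (ρ b) x + 1 < D (ρ b) b ∨ D (ρ b) x + 1 = D (ρ b) b := by omega
              rcases hlt' with h' | h'
              · omega
              · exfalso
                have : (π x) = b := hDinj (ρ b) (π x) b (by rw [e, h'])
                exact hbx this.symm
        · rintro (hbx | ⟨hbu, hb, h⟩)
          · -- `b = (π x)`: its arc covers `x`
            subst hbx
            refine ⟨hfx, ?_⟩
            have e := hDstep (ρ (π x)) x
            by_cases hne : D (ρ (π x)) x + 1 = m
            · rw [if_pos hne] at e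
              exact absurd ((hD0 _ _).mp e) hfx
            · rw [if_neg hne] at e; omega
          · refine ⟨hb, ?_⟩
            have e := hDstep (ρ b) x
            by_cases hne : D (ρ b) x + 1 = m
            · rw [if_pos hne] at e
              have : ρ b = (π x) := (hD0 (ρ b) (π x)).mp e
              have hbu' : b = u := by rw [hu, ← this]; simp
              exact absurd hbu' hbu
            · rw [if_neg hne] at e; omega
      have hxnot : (π x) ∉ (NF.filter fun b => D (ρ b) (π x) < D (ρ b) b).erase u := by
        simp only [Finset.mem_erase, Finset.mem_filter, memNF, not_and]
        intro _ _ h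
        exact absurd h (lt_irrefl _)
      have huin : u ∈ NF.filter fun b => D (ρ b) (π x) < D (ρ b) b := by
        simp only [Finset.mem_filter, memNF]
        refine ⟨huNF, ?_⟩
        rw [hρu, (hD0 (π x) (π x)).mpr rfl]
        have := hL1 u huNF; rw [hρu] at this; omega
      simp only [hcov]
      rw [key, Finset.card_insert_of_notMem hxnot, Finset.card_erase_of_mem huin]
      have : 1 ≤ (NF.filter fun b => D (ρ b) (π x) < D (ρ b) b).card := Finset.card_pos.mpr ⟨u, huin⟩
      omega
  -- hence the coverage is constant
  have cov_const : ∀ x, cov x = cov p := by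
    have hpow : ∀ (i : ℕ) (x : Fin m), cov ((π ^ i) x) = cov x := by
      intro i
      induction i with
      | zero => intro x; simp
      | succ i ih => intro x; rw [pow_succ', Equiv.Perm.mul_apply, cov_step, ih]
    intro x
    obtain ⟨i, -, hi⟩ := (hcyc x).exists_pow_eq'
    rw [← hi, hpow]
  -- (1) the bad counts sum to `cov q₁ + cov q₂ + #(NF ∩ R)`; the arcs through `p` number `cov p + 1`
  have sum_bad_q : ∀ q, ∑ b ∈ NF, (if D (ρ b) q < D (ρ b) b then 1 else 0) = cov q := by
    intro q; simp only [hcov]; rw [Finset.card_filter]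
  have sum_R : ∑ b ∈ NF, (if b = r₁ ∨ b = r₂ then 1 else 0) ≤ 1 := by
    rw [← Finset.card_filter]
    rw [Finset.card_le_one]
    intro a ha b hb
    simp only [Finset.mem_filter] at ha hb
    -- both are the bad column other than `p`
    have key : ∀ c, c ∈ NF → (c = r₁ ∨ c = r₂) → c = (if p = r₁ then r₂ else r₁) := by
      intro c hc hcR
      have hcp : c ≠ p := fun e => hpNF (e ▸ hc)
      rcases hpR with h | h
      · rw [if_pos h]
        rcases hcR with e | e
        · exact absurd (e.trans h.symm) hcp
        · exact e
      · rw [if_neg (fun e => hr (e.symm.trans h) |>.elim)]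
        rcases hcR with e | e
        · exact e
        · exact absurd (e.trans h.symm) hcp
    rw [key a ha.1 ha.2, key b hb.1 hb.2]
  have sum_p : ∑ b ∈ NF, (if D (ρ b) p ≤ D (ρ b) b then 0 else 1) + cov p = NF.card := by
    -- `[p ∈ I_b] = [D p < L b] + [b = p]`
    have e1 : ∑ b ∈ NF, (if D (ρ b) p ≤ D (ρ b) b then 0 else 1) + ∑ b ∈ NF, (if D (ρ b) p ≤ D (ρ b) b then 1 else 0) = NF.card := by
      rw [← Finset.sum_add_distrib]
      rw [Finset.card_eq_sum_ones]
      exact Finset.sum_congr rfl fun b _ => by split_ifs <;> rfl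
    have e2 : ∑ b ∈ NF, (if D (ρ b) p ≤ D (ρ b) b then 1 else 0) =
        ∑ b ∈ NF, (if D (ρ b) p < D (ρ b) b then 1 else 0) + ∑ b ∈ NF, (if b = p then 1 else 0) := by
      rw [← Finset.sum_add_distrib]
      refine Finset.sum_congr rfl fun b _ => ?_
      by_cases hbp : b = p
      · subst hbp; simp
      · have hne : D (ρ b) p ≠ D (ρ b) b := fun h => hbp (hDinj _ _ _ h).symm
        rw [if_neg hbp]
        by_cases h : D (ρ b) p < D (ρ b) b
        · rw [if_pos h.le, if_pos h]
        · rw [if_neg (by omega), if_neg h]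
    rw [e2, sum_bad_q p, Finset.sum_ite_eq' NF p, if_neg hpNF] at e1
    omega
  -- (2) summing `H` over the moved columns: `cov p ≥ #NF − 1`
  have hge : NF.card ≤ cov p + 1 := by
    have hsum : ∑ b ∈ NF, 2 ≤ ∑ b ∈ NF, ((if D (ρ b) q₁ < D (ρ b) b then 1 else 0) + (if D (ρ b) q₂ < D (ρ b) b then 1 else 0) +
        (if b = r₁ ∨ b = r₂ then 1 else 0) + (if D (ρ b) p ≤ D (ρ b) b then 0 else 1)) :=
      Finset.sum_le_sum fun b hb => H b ((memNF b).mp hb)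
    rw [Finset.sum_const, smul_eq_mul, Finset.sum_add_distrib, Finset.sum_add_distrib, Finset.sum_add_distrib, sum_bad_q q₁,
      sum_bad_q q₂, cov_const q₁, cov_const q₂] at hsum
    have := sum_p
    omega
  -- (3) total length: `m · cov p ≤ #NF · (m − 2) + #coincidences`
  have cov_le : ∀ b, ρ b ≠ b → (univ.filter fun x => D (ρ b) x < D (ρ b) b).card ≤ D (ρ b) b := by
    intro b _
    -- `x ↦ D (ρ b) x` is injective into `range (L b)`
    have h := Finset.card_le_card_of_injOn (fun x => D (ρ b) x) (s := univ.filter fun x => D (ρ b) x < D (ρ b) b)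
      (t := Finset.range (D (ρ b) b)) (fun x hx => by
        simp only [Finset.coe_filter, Finset.mem_univ, true_and, Set.mem_setOf_eq] at hx
        simpa using hx)
      (fun x _ x' _ h => hDinj _ _ _ h)
    simpa using h
  have total : m * cov p = ∑ b ∈ NF, (univ.filter fun x => D (ρ b) x < D (ρ b) b).card := by
    have e : ∑ x ∈ (univ : Finset (Fin m)), cov x = m * cov p := by
      rw [Finset.sum_congr rfl fun x _ => cov_const x, Finset.sum_const, smul_eq_mul, Finset.card_univ, Fintype.card_fin]
    rw [← e]
    simp only [hcov]
    simp only [Finset.card_filter]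
    rw [Finset.sum_comm]
  set C : Finset (Fin m) := NF.filter fun b => ρ b = π b with hC
  have hlen : ∑ b ∈ NF, (univ.filter fun x => D (ρ b) x < D (ρ b) b).card ≤ NF.card * (m - 2) + C.card := by
    have hpt : ∀ b ∈ NF, (univ.filter fun x => D (ρ b) x < D (ρ b) b).card ≤ (m - 2) + (if ρ b = π b then 1 else 0) := by
      intro b hb
      have hb' := (memNF b).mp hb
      have h1 := cov_le b hb'
      by_cases hc : ρ b = π b
      · rw [if_pos hc]; have := hLm b; omega
      · rw [if_neg hc]
        have : D (ρ b) b ≠ m - 1 := fun h => hc (hLcoin b h)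
        have := hLm b; omega
    refine le_trans (Finset.sum_le_sum hpt) ?_
    rw [Finset.sum_add_distrib, Finset.sum_const, smul_eq_mul, ← Finset.card_filter]
  -- (4) at most three coincidences, two if `y` is fixed
  have hCsub : C ⊆ ((NF.filter fun b => b = r₁ ∨ b = r₂) ∪ (NF.filter fun b => b = y)) := by
    intro b hb
    simp only [hC, Finset.mem_filter] at hb
    simp only [Finset.mem_union, Finset.mem_filter]
    rcases hcoin b hb.2 with h | h | h
    · exact Or.inl ⟨hb.1, Or.inl h⟩
    · exact Or.inl ⟨hb.1, Or.inr h⟩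
    · exact Or.inr ⟨hb.1, h.1⟩
  have hR1 : (NF.filter fun b => b = r₁ ∨ b = r₂).card ≤ 1 := by
    rw [Finset.card_filter]; exact sum_R
  have hCcard : C.card ≤ 1 + (NF.filter fun b => b = y).card :=
    le_trans (Finset.card_le_card hCsub) (le_trans (Finset.card_union_le _ _) (by omega))
  -- (5) the count of moved columns: `m − 1 ≤ #NF`, and `#NF = m` unless `y` is fixed
  have hNFcard : NF.card + (univ.filter fun b => ρ b = b).card = m := by
    have := Finset.card_filter_add_card_filter_not (s := (univ : Finset (Fin m))) (fun b => ρ b ≠ b)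
    simp only [not_not, Finset.card_univ, Fintype.card_fin] at this
    rw [hNF]; exact this
  have hfix1 : (univ.filter fun b => ρ b = b).card ≤ 1 + (univ.filter fun b => ρ b = b ∧ b = y).card := by
    have hsub : (univ.filter fun b => ρ b = b) ⊆ {p} ∪ (univ.filter fun b => ρ b = b ∧ b = y) := by
      intro b hb
      simp only [Finset.mem_filter, Finset.mem_univ, true_and] at hb
      simp only [Finset.mem_union, Finset.mem_singleton, Finset.mem_filter, Finset.mem_univ, true_and]
      rcases hfixsub b hb with h | h
      · exact Or.inr ⟨hb, h⟩
      · exact Or.inl h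
    refine le_trans (Finset.card_le_card hsub) (le_trans (Finset.card_union_le _ _) ?_)
    rw [Finset.card_singleton]
  have hpfix : 1 ≤ (univ.filter fun b => ρ b = b).card :=
    Finset.card_pos.mpr ⟨p, by simp [hp]⟩
  have hyfix : (univ.filter fun b => ρ b = b ∧ b = y).card ≤ 1 := by
    rw [Finset.card_le_one]; intro a ha b hb
    simp only [Finset.mem_filter, Finset.mem_univ, true_and] at ha hb; rw [ha.2, hb.2]
  have hyNF : (NF.filter fun b => b = y).card + (univ.filter fun b => ρ b = b ∧ b = y).card ≤ 1 := by
    -- `y` is moved or fixed, not both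
    by_cases hy : ρ y = y
    · have h0 : (NF.filter fun b => b = y).card = 0 := by
        rw [Finset.card_eq_zero, Finset.filter_eq_empty_iff]
        intro b hb hby
        rw [memNF] at hb; rw [hby] at hb; exact hb hy
      omega
    · have h0 : (univ.filter fun b => ρ b = b ∧ b = y).card = 0 := by
        rw [Finset.card_eq_zero, Finset.filter_eq_empty_iff]
        intro b _ hb
        rw [hb.2] at hb; exact hy hb.1
      have h1 : (NF.filter fun b => b = y).card ≤ 1 := by
        rw [Finset.card_le_one]; intro a ha b hb
        simp only [Finset.mem_filter] at ha hb; rw [ha.2, hb.2]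
      omega
  -- (6) arithmetic
  have hm' : m - 2 + 2 = m := by omega
  have key1 : m * cov p ≤ NF.card * (m - 2) + C.card := by rw [total]; exact hlen
  have key2 : m * (NF.card - 1) ≤ m * cov p := Nat.mul_le_mul_left _ (by omega)
  -- `m (#NF − 1) ≤ #NF (m − 2) + #C` with `#C + #fixed ≤ 3`, `#NF + #fixed = m`, `m ≥ 5`: impossible
  have hNF1 : 1 ≤ NF.card := by
    rcases hpR with h | h
    · exact Finset.card_pos.mpr ⟨r₂, hr2NF (fun e => hr (h.symm.trans e.symm))⟩
    · exact Finset.card_pos.mpr ⟨r₁, hr1NF (fun e => hr (e.trans h))⟩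
  set F := (univ.filter fun b => ρ b = b).card with hF
  set Fy := (univ.filter fun b => ρ b = b ∧ b = y).card with hFy
  set N := NF.card with hN
  set Cc := C.card with hCc
  have e3 : m * (N - 1) ≤ N * (m - 2) + Cc := le_trans key2 key1
  -- expand in ℤ
  have hNm : N ≤ m := by omega
  zify [hNm, hNF1, (by omega : 2 ≤ m)] at e3 hNFcard hCcard hyNF hfix1 hpfix hyfix
  nlinarith [e3, hNFcard, hCcard, hyNF, hfix1, hpfix, hyfix, hm]

end LexCore

end Summit.ValiantsHypothesis.ValiantsHypothesis.Theorems.KPlusLogSqLaw
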